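/-
Copyright (c) 2026. All rights reserved.
Released under Apache 2.0 license as described in the file LICENSE.
Authors: abc-iut cell, wave-5 seat abc-iut-w5-d141 (L3 sub-DAG [SemiAnbd] Thm 5.4, junction binder `hadj`).
-/
import Literature.AnabelianGeometry.SemiGraphs.ArithEdgeLikeTwoHosts
import Literature.AnabelianGeometry.SemiGraphs.ArithLevelData
import Literature.AnabelianGeometry.SemiGraphs.TemperedEdgeLikeCommensurator
import Literature.AnabelianGeometry.SemiGraphs.TemperedThm37OfCompactInVerticialAt
import Literature.AnabelianGeometry.SemiGraphs.TemperedReconstructionReductions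
import HarnessLib

/-!
# [SemiAnbd] Thm 5.4 (iii) junction: the binder `hadj` (the `𝔊`-side shadow of the geometric
# Thm 3.7 (iii)) DISCHARGED at the produced decomposition data (proof-only)

Mochizuki, *Semi-graphs of anabelioids*, Publ. RIMS **42** (2006), §3 Thm 3.7 (iii) pp. 40–41 ("if a
nontrivial compact subgroup … is contained in more than one verticial subgroup, then it is contained in
precisely two verticial subgroups … joined to one another by a single edge … this compact subgroup is
contained in [an edge-like subgroup]"), §5 p. 65 ("`Π^temp_{𝔊,v}` … the commensurator in `Π^temp_𝔊` of
`Π^temp_{𝔾,v}`"; "`Π^temp_{𝔊,b} ⊆ Π^temp_{𝔊,v}` … the commensurator in `Π^temp_{𝔊,v}` of `Π^temp_{𝔾,b}`"),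
Thm 5.4 (iii) p. 66 ("entirely parallel to … Theorem 3.7, Corollary 3.9")
[cite: MochizukiSemiAnbd2006, Thm 5.4 (iii), p. 66].

PROOF-ONLY (cell abc-iut, layer L3, sub-DAG `plan/L3/SUBDAG-SemiAnbd-Thm54.md`; no definition, no named
fact, nothing asserted).  The Thm 5.4 (iii) umbrella (`ArithQuasiGeometricSurjectiveCompat.lean`,
`ArithThm54iiiUmbrella(Compat).lean`, abc-iut-w5-d141) carries the binder

  `hadj : ∀ v₁ v₂ γ₁ γ₂, γ₁·Π^temp_{𝔊,v₁}·γ₁⁻¹ ∩ Ker ≠ γ₂·Π^temp_{𝔊,v₂}·γ₂⁻¹ ∩ Ker →`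
  `  γ₁·Π^temp_{𝔊,v₁}·γ₁⁻¹ ∩ γ₂·Π^temp_{𝔊,v₂}·γ₂⁻¹ ∩ Ker ≠ 1 → ∃ E edge-like, E ≤ γ₁·Π^temp_{𝔊,v₁}·γ₁⁻¹ ∩ γ₂·Π^temp_{𝔊,v₂}·γ₂⁻¹`

over ABSTRACT decomposition data `D`.  This file proves it AT THE PRODUCED DATA
`D := decompositionDataOfChart R ι` of abc-iut-w4-d053 (`Π^temp_{𝔊,v} := C(ι Π^temp_{𝔾,v})`,
`Π^temp_{𝔊,b} := Π^temp_{𝔊,v(b)} ∩ C(ι Π^temp_{𝔾,b})`), from: Thm 3.7 (iii) AT `𝒢` (`CompactInVerticialAt`),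
the Cor 3.9 frame (`Cor39Hypotheses`: Thm 3.7 hypotheses + graph), the inclusion
`ι : Π^temp_𝔾 ↪ Π^temp_𝔊` with `range ι = Ker aug` (Prop 5.2 (iv)), and the `ArithChartAction` of
abc-iut-w4-d053 / abc-iut-w4-d083 (conjugation by `Π^temp_𝔊` carries verticial / edge-like subgroups of
`Π^temp_𝔾` to verticial / edge-like subgroups, Def 5.1 (i) through Prop 3.6 (iv)).

Route.  The geometric parts `γᵢ·Π^temp_{𝔊,vᵢ}·γᵢ⁻¹ ∩ Ker = ι(Kᵢ)` are verticial and
`γᵢ·Π^temp_{𝔊,vᵢ}·γᵢ⁻¹ = C(ι Kᵢ)`; `K₁ ≠ K₂`, `K₁ ∩ K₂ ≠ 1` compact, so Thm 3.7 (iii) at `𝒢` gives an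
edge-like `L ⊇ K₁ ∩ K₂` of a closed edge `e`, and `L = K₁ ∩ K₂` (`EdgeLikeIsInfVerticialAt` + the
uniqueness clause); `L = δ·Π^temp_{𝔾,b}·δ⁻¹` for a branch `b` of `e` at `v(b)` (one conjugacy class per
edge), `H₃ := δ·Π^temp_{𝔾,v(b)}·δ⁻¹ ⊇ L` is `K₁` or `K₂`, and `E := ι(δ)·Π^temp_{𝔊,b}·ι(δ)⁻¹ = C(ι H₃) ∩ C(ι L)`
is edge-like for `D` by definition.  The KEY LEMMA `commensurator_inf_commensurator_le_of_hosts`: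
`C(ι K₁) ∩ C(ι L) ≤ C(ι K₂)` — conjugation by such an `x` fixes `K₁` (commensurable verticial subgroups
coincide, Thm 3.7 (ii)) and `L` (`eq_of_commensurable_of_mem_edgeLikeSubgroupsAt`), so it carries `K₂` to
a verticial subgroup containing `L`, i.e. to `K₁` or `K₂` (Thm 3.7 (iii)), not to `K₁ = x·K₁·x⁻¹`; hence
it normalises `ι(K₂)`.  (This is where "an element commensurating `Π^temp_{𝔾,e}` AND one end-host cannot
switch the ends" replaces the LEVEL-A input (H-CE) of `ArithEdgeLikeTwoHosts.lean`; no "no branch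
switching" hypothesis is needed for `hadj`, because `Π^temp_{𝔊,b}` lies inside `Π^temp_{𝔊,v(b)}` by
construction.)  Typed ≠ proved for the inputs; nothing here bears on [IUTchIII] Cor. 3.12.
-/

namespace Literature.AnabelianGeometry.SemiGraphs

namespace ProfiniteSemiGraph

open _root_.Topology
open scoped Pointwise

universe u uG uP

variable {𝒢 : ProfiniteSemiGraph.{u}} {c : TemperedPiChart 𝒢}
variable {Gtp : Type uG} [Group Gtp]
variable {PA : Type uP} [Group PA] [TopologicalSpace PA]

/-- `conjSubgroup` is the `ConjAct` action (definitional bookkeeping). [cite: MochizukiSemiAnbd2006, §0, p. 5] -/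
private theorem conjSubgroup_eq_smul (y : Gtp) (S : Subgroup Gtp) :
    conjSubgroup y S = ConjAct.toConjAct y • S := rfl

/-! ### The key lemma: an element commensurating one end-host and the edge group fixes the other end-host -/

/-- **KEY LEMMA** (the arithmetic content of "joined to one another by a single edge", Thm 3.7 (iii)
p. 41, read in `Π^temp_𝔊` ⊇ `ι(Π^temp_𝔾)`): for distinct verticial `K₁ ≠ K₂` of `π₁^temp(𝒢)` and an
edge-like `L ≤ K₁ ∩ K₂`, every `x ∈ Π^temp_𝔊` commensurating `ι(K₁)` and `ι(L)` commensurates (indeed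
normalises) `ι(K₂)`: conjugation by `x` (which acts on the verticial / edge-like subgroups of `Π^temp_𝔾`,
`ArithChartAction`) fixes `K₁` (commensurable verticial subgroups are equal — both are commensurably
terminal, Thm 3.7 (ii)) and `L` (commensurable edge-like subgroups are equal,
`eq_of_commensurable_of_mem_edgeLikeSubgroupsAt`), so `x·K₂·x⁻¹` is a verticial subgroup containing the
nontrivial compact `L`, hence `K₁` or `K₂` (Thm 3.7 (iii) at `𝒢`), and not `K₁ = x·K₁·x⁻¹`.
[cite: MochizukiSemiAnbd2006, Thm 3.7 (iii), p. 41] -/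
theorem commensurator_inf_commensurator_le_of_hosts (h𝒢iii : CompactInVerticialAt 𝒢)
    (h𝒢 : Cor39Hypotheses 𝒢) (ι : c.G →* Gtp) (hι : Function.Injective ι) (aug : Gtp →* PA)
    {actV : PA → 𝒢.graph.Vertex → 𝒢.graph.Vertex} {actE : PA → 𝒢.graph.Edge → 𝒢.graph.Edge}
    {actB : PA → 𝒢.graph.Branch → 𝒢.graph.Branch} (A : ArithChartAction c ι aug actV actE actB)
    {v₁ v₂ : 𝒢.graph.Vertex} {e : 𝒢.graph.Edge} {K₁ K₂ L : Subgroup c.G}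
    (hK₁ : K₁ ∈ verticialSubgroups c v₁) (hK₂ : K₂ ∈ verticialSubgroups c v₂) (hne : K₁ ≠ K₂)
    (hL : L ∈ edgeLikeSubgroups c e) (hL₁ : L ≤ K₁) (hL₂ : L ≤ K₂) :
    Subgroup.Commensurable.commensurator (K₁.map ι) ⊓ Subgroup.Commensurable.commensurator (L.map ι) ≤
      Subgroup.Commensurable.commensurator (K₂.map ι) := by
  intro x hx
  obtain ⟨hx₁, hxL⟩ := Subgroup.mem_inf.mp hx
  have h37 := h𝒢.thm37Hypotheses
  have hG : 𝒢.graph.IsGraph := h𝒢.isGraph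
  -- conjugation by `x` on the three subgroups, through the chart action
  obtain ⟨K₁', hK₁', hcK₁⟩ := A.conj_verticial x v₁ K₁ hK₁
  obtain ⟨K₂', hK₂', hcK₂⟩ := A.conj_verticial x v₂ K₂ hK₂
  obtain ⟨L', hL', hcL⟩ := A.conj_edgeLike x e L hL
  -- (a) `x·K₁·x⁻¹ = K₁`
  rw [Subgroup.Commensurable.commensurator_mem_iff, ← conjSubgroup_eq_smul, hcK₁,
    commensurable_map_iff_of_injective hι] at hx₁
  have hK₁eq : K₁' = K₁ := by
    have h := Subgroup.Commensurable.eq hx₁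
    rwa [commensurator_eq_of_mem_verticialSubgroups h37 c hK₁',
      commensurator_eq_of_mem_verticialSubgroups h37 c hK₁] at h
  -- (b) `x·L·x⁻¹ = L`
  rw [Subgroup.Commensurable.commensurator_mem_iff, ← conjSubgroup_eq_smul, hcL,
    commensurable_map_iff_of_injective hι] at hxL
  have hLeq : L' = L := eq_of_commensurable_of_mem_edgeLikeSubgroupsAt h𝒢iii h37 hG c hL' hL hxL
  -- (c) `L ≤ x·K₂·x⁻¹`
  have hLK₂' : L ≤ K₂' := by
    rw [← hLeq, ← Subgroup.map_le_map_iff_of_injective hι, ← hcL, ← hcK₂]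
    exact Subgroup.map_mono (Subgroup.map_mono hL₂)
  -- (d) the uniqueness clause of Thm 3.7 (iii) at `𝒢` for the nontrivial compact `L`
  have hLc : IsCompact (L : Set c.G) := isCompact_of_mem_edgeLikeSubgroups c hL
  haveI : Infinite L := infinite_of_mem_edgeLikeSubgroups verticialInjective_holds h37 c hL
  have hL0 : L ≠ ⊥ := by
    intro h0
    haveI : Finite L := by rw [h0]; infer_instance
    exact not_finite L
  obtain ⟨hU, -⟩ := (h𝒢iii h37 c L hLc).2 hL0 v₁ v₂ K₁ K₂ hK₁ hK₂ hne hL₁ hL₂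
  rcases hU _ K₂' hK₂' hLK₂' with h | h
  · -- `x·K₂·x⁻¹ = K₁ = x·K₁·x⁻¹` would force `K₂ = K₁`
    exfalso
    apply hne
    have hc : conjSubgroup x (K₁.map ι) = conjSubgroup x (K₂.map ι) := by rw [hcK₂, hcK₁, h, hK₁eq]
    have hinj : Function.Injective (conjSubgroup x : Subgroup Gtp → Subgroup Gtp) :=
      Subgroup.map_injective (MulAut.conj x).injective
    exact Subgroup.map_injective hι (hinj hc)
  · rw [Subgroup.Commensurable.commensurator_mem_iff, ← conjSubgroup_eq_smul, hcK₂, h]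

/-! ### `hadj` at the produced data -/

/-- **The umbrella binder `hadj` DISCHARGED at the produced decomposition data** `decompositionDataOfChart R ι`
([SemiAnbd] Thm 5.4 (iii) p. 66 "entirely parallel to … Theorem 3.7", with §5 p. 65 and Thm 3.7 (iii)
pp. 40–41): if two conjugates `γ₁·Π^temp_{𝔊,v₁}·γ₁⁻¹`, `γ₂·Π^temp_{𝔊,v₂}·γ₂⁻¹` of the produced vertex groups have
DISTINCT geometric parts meeting NONTRIVIALLY (inside `Ker aug = ι(Π^temp_𝔾)`), then some edge-like subgroup of
the produced data (a conjugate of some `Π^temp_{𝔊,b}`) lies in both.  Inputs: Thm 3.7 (iii) at `𝒢`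
(`CompactInVerticialAt`), the Cor 3.9 frame, `ι` injective with `range ι = Ker aug` (Prop 5.2 (iv)), and the
`ArithChartAction` (Def 5.1 (i) via Prop 3.6 (iv)).  The conclusion is the `hadj` binder of
`Thm54iii.clause3Compat_of_geometric` / `arithQuasiGeometricCorrespondenceStatementCompat_of_iota'` VERBATIM
with `D := decompositionDataOfChart R ι`, `augG := aug`. [cite: MochizukiSemiAnbd2006, Thm 5.4 (iii), p. 66] -/
theorem hadj_decompositionDataOfChart (h𝒢iii : CompactInVerticialAt 𝒢) (h𝒢 : Cor39Hypotheses 𝒢)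
    (R : ChartRepresentatives c) (ι : c.G →* Gtp) (hι : Function.Injective ι) (aug : Gtp →* PA)
    (hexact : ι.range = aug.ker)
    {actV : PA → 𝒢.graph.Vertex → 𝒢.graph.Vertex} {actE : PA → 𝒢.graph.Edge → 𝒢.graph.Edge}
    {actB : PA → 𝒢.graph.Branch → 𝒢.graph.Branch} (A : ArithChartAction c ι aug actV actE actB) :
    ∀ (v₁ v₂ : 𝒢.graph.Vertex) (γ₁ γ₂ : Gtp),
      conjSubgroup γ₁ ((decompositionDataOfChart R ι).vertGp v₁) ⊓ aug.ker ≠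
          conjSubgroup γ₂ ((decompositionDataOfChart R ι).vertGp v₂) ⊓ aug.ker →
      conjSubgroup γ₁ ((decompositionDataOfChart R ι).vertGp v₁) ⊓
          conjSubgroup γ₂ ((decompositionDataOfChart R ι).vertGp v₂) ⊓ aug.ker ≠ ⊥ →
        ∃ E : Subgroup Gtp, IsEdgeLike (decompositionDataOfChart R ι) E ∧
          E ≤ conjSubgroup γ₁ ((decompositionDataOfChart R ι).vertGp v₁) ⊓
            conjSubgroup γ₂ ((decompositionDataOfChart R ι).vertGp v₂) := by
  intro v₁ v₂ γ₁ γ₂ hne hnt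
  haveI : aug.ker.Normal := MonoidHom.normal_ker aug
  haveI := TemperedPiChart.t2Space c
  have h37 := h𝒢.thm37Hypotheses
  have hG : 𝒢.graph.IsGraph := h𝒢.isGraph
  -- the geometric parts of the two arithmetic vertex groups
  obtain ⟨K₁, hK₁, hcK₁⟩ := A.conj_verticial γ₁ v₁ (R.Hv v₁) (R.Hv_mem v₁)
  obtain ⟨K₂, hK₂, hcK₂⟩ := A.conj_verticial γ₂ v₂ (R.Hv v₂) (R.Hv_mem v₂)
  have hgeom : ∀ (γ : Gtp) (v : 𝒢.graph.Vertex) (K : Subgroup c.G),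
      conjSubgroup γ ((R.Hv v).map ι) = K.map ι →
        conjSubgroup γ ((decompositionDataOfChart R ι).vertGp v) ⊓ aug.ker = K.map ι := by
    intro γ v K hcK
    rw [← conjSubgroup_inf_of_normal, decompositionDataOfChart_vertGp, ← hexact,
      arithVertGp_inf_range_eq_map h37 R ι hι v, hcK]
  have hcomm : ∀ (γ : Gtp) (v : 𝒢.graph.Vertex) (K : Subgroup c.G),
      conjSubgroup γ ((R.Hv v).map ι) = K.map ι →
        conjSubgroup γ ((decompositionDataOfChart R ι).vertGp v) =
          Subgroup.Commensurable.commensurator (K.map ι) := by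
    intro γ v K hcK
    rw [← hcK, commensurator_conjSubgroup]
    rfl
  have hV₁ := hgeom γ₁ v₁ K₁ hcK₁
  have hV₂ := hgeom γ₂ v₂ K₂ hcK₂
  -- `K₁ ≠ K₂`, `K₁ ∩ K₂ ≠ 1` compact
  have hne' : K₁ ≠ K₂ := fun h => hne (by rw [hV₁, hV₂, h])
  have hnt' : K₁ ⊓ K₂ ≠ ⊥ := by
    intro h
    apply hnt
    rw [inf_inf_distrib_right, hV₁, hV₂, ← Subgroup.map_inf K₁ K₂ ι hι, h, Subgroup.map_bot]
  have hcpt : IsCompact ((K₁ ⊓ K₂ : Subgroup c.G) : Set c.G) := by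
    rw [Subgroup.coe_inf]
    exact (isCompact_of_mem_verticialSubgroups c hK₁).inter_right
      (isCompact_of_mem_verticialSubgroups c hK₂).isClosed
  -- Thm 3.7 (iii) at `𝒢`: an edge-like `L ⊇ K₁ ∩ K₂` of a closed edge `e`, and the uniqueness clause
  obtain ⟨hU, e, L, he, hL, hCL⟩ :=
    (h𝒢iii h37 c (K₁ ⊓ K₂) hcpt).2 hnt' _ _ K₁ K₂ hK₁ hK₂ hne' inf_le_left inf_le_right
  -- `L = K₁ ∩ K₂`
  have hL0 : L ≠ ⊥ := fun h0 => hnt' (le_bot_iff.mp (h0 ▸ hCL))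
  obtain ⟨u₁, u₂, H₁, H₂, hH₁, hH₂, hHne, hLH⟩ :=
    edgeLikeIsInfVerticialAt_of_compactInVerticialAt h𝒢iii h37 c e he L hL hL0
  have hL₁ : L ≤ K₁ := by
    rcases hU u₁ H₁ hH₁ (hCL.trans (hLH ▸ inf_le_left)) with h | h
    · exact hLH.trans_le (inf_le_left.trans h.le)
    · rcases hU u₂ H₂ hH₂ (hCL.trans (hLH ▸ inf_le_right)) with h' | h'
      · exact hLH.trans_le (inf_le_right.trans h'.le)
      · exact absurd (h.trans h'.symm) hHne
  have hL₂ : L ≤ K₂ := by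
    rcases hU u₁ H₁ hH₁ (hCL.trans (hLH ▸ inf_le_left)) with h | h
    · rcases hU u₂ H₂ hH₂ (hCL.trans (hLH ▸ inf_le_right)) with h' | h'
      · exact absurd (h.trans h'.symm) hHne
      · exact hLH.trans_le (inf_le_right.trans h'.le)
    · exact hLH.trans_le (inf_le_left.trans h.le)
  -- a branch `b` of `e` at `v(b)`; `L = δ·Π^temp_{𝔾,b}·δ⁻¹`
  obtain ⟨b, -, -, hbe, -, -⟩ := 𝒢.graph.two_branches e
  obtain ⟨vb, hbv⟩ := Option.isSome_iff_exists.mp (hG.abuts_isSome b)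
  have hRb : R.Hb b ∈ edgeLikeSubgroups c e := hbe ▸ R.Hb_mem b
  obtain ⟨δ, hLδ⟩ := exists_conj_of_mem_edgeLikeSubgroups c hRb hL
  -- `H₃ := δ·Π^temp_{𝔾,v(b)}·δ⁻¹ ⊇ L` is `K₁` or `K₂`
  have hH₃ : (R.Hv vb).map (MulAut.conj δ).toMonoidHom ∈ verticialSubgroups c vb :=
    conj_mem_verticialSubgroups c (R.Hv_mem vb) δ
  have hLH₃ : L ≤ (R.Hv vb).map (MulAut.conj δ).toMonoidHom :=
    hLδ ▸ Subgroup.map_mono (R.Hb_le b vb hbv)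
  have hH₃' := hU vb _ hH₃ (hCL.trans hLH₃)
  -- the arithmetic edge-like subgroup `E := ι(δ)·Π^temp_{𝔊,b}·ι(δ)⁻¹ = C(ι H₃) ∩ C(ι L)`
  refine ⟨conjSubgroup (ι δ) ((decompositionDataOfChart R ι).brGp b), ⟨b, ι δ, rfl⟩, ?_⟩
  have hE : conjSubgroup (ι δ) ((decompositionDataOfChart R ι).brGp b) =
      Subgroup.Commensurable.commensurator (((R.Hv vb).map (MulAut.conj δ).toMonoidHom).map ι) ⊓
        Subgroup.Commensurable.commensurator (L.map ι) := by
    rw [decompositionDataOfChart_brGp, arithBrGp_of_abuts R ι hbv, conjSubgroup_inf, hLδ,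
      map_conjSubgroup_eq, map_conjSubgroup_eq, commensurator_conjSubgroup, commensurator_conjSubgroup]
    rfl
  rw [hE, hcomm γ₁ v₁ K₁ hcK₁, hcomm γ₂ v₂ K₂ hcK₂]
  rcases hH₃' with h3 | h3
  · rw [h3]
    exact le_inf inf_le_left
      (commensurator_inf_commensurator_le_of_hosts h𝒢iii h𝒢 ι hι aug A hK₁ hK₂ hne' hL hL₁ hL₂)
  · rw [h3]
    exact le_inf
      (commensurator_inf_commensurator_le_of_hosts h𝒢iii h𝒢 ι hι aug A hK₂ hK₁ hne'.symm hL hL₂ hL₁)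
      inf_le_left


/-! ### Two more umbrella binders at the produced data: `hEgeom` and `hslim`

(Appended, proof-only.)  The compat umbrella `arithQuasiGeometricCorrespondenceStatementCompat_of_iota'`
also binds `hEgeom` ("the geometric branch groups `y·Π^temp_{𝔊,b}·y⁻¹ ∩ Ker` are non-trivial") and
`hslim` ("the geometric verticial parts `x·Π^temp_{𝔊,w}·x⁻¹ ∩ Ker` are slim").  At the produced data both
are chart-level facts: the geometric part of a conjugate branch group is `ι` of an edge-like subgroup
(`A.conj_edgeLike`, `arithBrGp_inf_range_eq_mapAt` — Thm 3.7 (iii) at `𝒢`), and edge-like subgroups are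
infinite (`infinite_of_mem_edgeLikeSubgroups`, Thm 3.7 (i) + total elevation); the geometric part of a
conjugate vertex group is `ι` of a verticial subgroup, i.e. an injective continuous image of a vertex group
`Π_v` (Thm 3.7 (i) `verticialInjective_holds`), and `Π_v` is slim by hypothesis ("verticially slim",
Prop 3.6 / Thm 3.7 frame) — slimness passes along a group isomorphism whose forward map is continuous.
[cite: MochizukiSemiAnbd2006, Thm 5.4 (iii), p. 66] -/

/-- **The umbrella binder `hEgeom` at the produced data**: the geometric part
`y·Π^temp_{𝔊,b}·y⁻¹ ∩ Ker aug` of every conjugate of every produced branch group is non-trivial — it is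
`ι(K′)` for an edge-like `K′` (Thm 3.7 (iii) at `𝒢` through `arithBrGp_inf_range_eq_mapAt` and the chart
action), and edge-like subgroups are infinite. [cite: MochizukiSemiAnbd2006, Thm 3.7 (i)(iii), pp. 40–41] -/
theorem hEgeom_decompositionDataOfChart (h𝒢iii : CompactInVerticialAt 𝒢) (h𝒢 : Cor39Hypotheses 𝒢)
    (R : ChartRepresentatives c) (ι : c.G →* Gtp) (hι : Function.Injective ι) (aug : Gtp →* PA)
    (hexact : ι.range = aug.ker)
    {actV : PA → 𝒢.graph.Vertex → 𝒢.graph.Vertex} {actE : PA → 𝒢.graph.Edge → 𝒢.graph.Edge}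
    {actB : PA → 𝒢.graph.Branch → 𝒢.graph.Branch} (A : ArithChartAction c ι aug actV actE actB) :
    ∀ (b : 𝒢.graph.Branch) (y : Gtp),
      conjSubgroup y ((decompositionDataOfChart R ι).brGp b) ⊓ aug.ker ≠ ⊥ := by
  intro b y
  haveI : aug.ker.Normal := MonoidHom.normal_ker aug
  have h37 := h𝒢.thm37Hypotheses
  have hG : 𝒢.graph.IsGraph := h𝒢.isGraph
  obtain ⟨K', hK', hcK⟩ := A.conj_edgeLike y (𝒢.graph.edgeOf b) (R.Hb b) (R.Hb_mem b)
  rw [← conjSubgroup_inf_of_normal, decompositionDataOfChart_brGp, ← hexact,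
    arithBrGp_inf_range_eq_mapAt h𝒢iii h37 hG R ι hι b, hcK]
  haveI : Infinite K' := infinite_of_mem_edgeLikeSubgroups verticialInjective_holds h37 c hK'
  intro h0
  rw [Subgroup.map_eq_bot_iff_of_injective K' hι] at h0
  haveI : Finite K' := by rw [h0]; infer_instance
  exact not_finite K'

/-- Slimness passes along a group isomorphism whose forward map is continuous (open subgroups pull back
to open subgroups, centralisers correspond). [cite: MochizukiSemiAnbd2006, §0, p. 5] -/
private theorem isSlimGroup_of_mulEquiv_of_continuous {A : Type*} {B : Type*} [Group A]
    [TopologicalSpace A] [Group B] [TopologicalSpace B] (e : A ≃* B) (he : Continuous e)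
    (hA : Literature.AlgebraicGeometry.Frobenioids.IsSlimGroup A) :
    Literature.AlgebraicGeometry.Frobenioids.IsSlimGroup B := by
  refine ⟨fun U hU => ?_⟩
  have hU' : IsOpen ((U.comap e.toMonoidHom : Subgroup A) : Set A) := hU.preimage he
  have h := hA.centralizer_eq_bot _ hU'
  refine (Subgroup.eq_bot_iff_forall _).mpr fun z hz => ?_
  have hz' : e.symm z ∈ Subgroup.centralizer ((U.comap e.toMonoidHom : Subgroup A) : Set A) := by
    rw [Subgroup.mem_centralizer_iff]
    intro a ha
    have ha' : e a ∈ U := ha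
    have hc := Subgroup.mem_centralizer_iff.mp hz (e a) ha'
    apply e.injective
    simpa [map_mul] using hc
  rw [h] at hz'
  have h1 : e.symm z = 1 := Subgroup.mem_bot.mp hz'
  simpa using congrArg e h1

/-- **The umbrella binder `hslim` at the produced data**: the geometric part
`x·Π^temp_{𝔊,w}·x⁻¹ ∩ Ker aug` of every conjugate of every produced vertex group is slim (for the topology
induced from `Π^temp_𝔊`) — it is `ι(K)` for a verticial `K = ψ(Π_v)` with `ψ` an injective verticial
homomorphism (Thm 3.7 (i)), `ι` is continuous and injective, and `Π_v` is slim ("verticially slim").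
[cite: MochizukiSemiAnbd2006, Thm 3.7 (i), p. 40] -/
theorem hslim_decompositionDataOfChart [TopologicalSpace Gtp] (h𝒢 : 𝒢.Thm37Hypotheses)
    (R : ChartRepresentatives c) (ι : c.G →* Gtp) (hι : Function.Injective ι) (hιc : Continuous ι)
    (aug : Gtp →* PA) (hexact : ι.range = aug.ker)
    {actV : PA → 𝒢.graph.Vertex → 𝒢.graph.Vertex} {actE : PA → 𝒢.graph.Edge → 𝒢.graph.Edge}
    {actB : PA → 𝒢.graph.Branch → 𝒢.graph.Branch} (A : ArithChartAction c ι aug actV actE actB) :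
    ∀ (w : 𝒢.graph.Vertex) (x : Gtp),
      Literature.AlgebraicGeometry.Frobenioids.IsSlimGroup
        (conjSubgroup x ((decompositionDataOfChart R ι).vertGp w) ⊓ aug.ker : Subgroup Gtp) := by
  intro w x
  haveI : aug.ker.Normal := MonoidHom.normal_ker aug
  obtain ⟨K, hK, hcK⟩ := A.conj_verticial x w (R.Hv w) (R.Hv_mem w)
  have hV : conjSubgroup x ((decompositionDataOfChart R ι).vertGp w) ⊓ aug.ker = K.map ι := by
    rw [← conjSubgroup_inf_of_normal, decompositionDataOfChart_vertGp, ← hexact,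
      arithVertGp_inf_range_eq_map h𝒢 R ι hι w, hcK]
  rw [hV]
  obtain ⟨ψ, hψ, rfl⟩ := hK
  rw [← MonoidHom.range_comp]
  have hθ : Function.Injective (ι.comp ψ.toMonoidHom) :=
    hι.comp ((verticialInjective_holds 𝒢 h𝒢 c _).2 ψ hψ)
  exact isSlimGroup_of_mulEquiv_of_continuous (MonoidHom.ofInjective hθ)
    (continuous_induced_rng.2 (hιc.comp ψ.continuous)) (h𝒢.isVerticiallySlim _)

end ProfiniteSemiGraph

end Literature.AnabelianGeometry.SemiGraphs
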